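import Summits.ValiantsHypothesis.ValiantsHypothesis.Theorems.LacunarySymmetroidMatrixDescartesPivotTwoDirections
import Summits.ValiantsHypothesis.ValiantsHypothesis.Theorems.LacunarySymmetroidMatrixDescartesCensusSignVariationsWindow
import Summits.ValiantsHypothesis.ValiantsHypothesis.Theorems.LacunarySymmetroidMatrixDescartesCensusFullAlternation

/-!
# `MatrixDescartes` census — SIGN-SEPARATED TWO-DIRECTION PENCILS: `Z₊ ≤ 2K` always, `Z₊ ≤ 2K − 2` off the interleaving locus
# (every `(K_u, K_v)`; the Descartes half of the BLOCK QUESTION «two directions ⇒ 2K − 2»)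

HONEST FRAMING.  Object-search cell `pub-symmetroid`, seat `val-sym-mdr-p1` (generation 13); helper file `--supports` the crux item
stmt-ValiantsHypothesis-18050 (`Theses.LacunarySymmetroid.MatrixDescartes`, OPEN, on HOLD) with NO closure claim.  Companion of
`…PivotTwoDirections` (val-sym-mdr-p1 g12: `Z₊ ≤ 2·K_u·K_v`, BLOCK QUESTION «`Z₊ ≤ 2K − 2`?»), `…PivotTwoDirectionsBlockLawAll`
(`(K_u,K_v) = (2,2)`: `Z₊ ≤ 6` everywhere) and `…CensusSignVariationsWindow` (two-ended budget / window lemma).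

SETTING (`det_twoDir`).  `F = X^e J + f·uuᵀ + g·vvᵀ` with DIRECTION POSYNOMIALS `f = ∑ cₖX^{pₖ}` (all degrees `< e`: the `u`-letters
sit below the pivot) and `g = ∑ cₗX^{qₗ}` (all degrees `> e`), non-negative coefficients, `f, g ≠ 0`; `K := #supp f + #supp g` is the
number of letters.  `Φ = det F = X^{2e}·det J + X^e f·m(J,u) + X^e g·m(J,v) + f g·Δ²` (`coeff_twoDirDet`).  In the HARD CELL
(`m(J,u) < 0`, `m(J,v) < 0`; `det J` arbitrary):
* `negSupp_subset` — negative coefficients only at the `K + 1` pivot-type degrees `2e`, `e + pₖ`, `e + qₗ`;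
* `trailingCoeff_twoDirDet = m(J,u)·trailingCoeff f < 0`, `leadingCoeff_twoDirDet = m(J,v)·leadingCoeff g < 0` — BOTH ENDS NEGATIVE
  (this is «both end islands unbounded», BLOCKS.md §4);
* **`twoDir_posRoots_le` / `twoDir_det_posRoots_le`: `Z₊ ≤ 2K`** (two-ended budget `Census.signVariations_two_ended_le`:
  `Var + 2 ≤ 2(K+1)`) — sharper than `2·K_u·K_v` as soon as `K_u, K_v ≥ 2` and `(K_u,K_v) ≠ (2,2)`;
* **`twoDir_posRoots_le_of_gap` / `twoDir_det_posRoots_le_of_gap`: `Z₊ ≤ 2K − 2`** whenever two pivot-type degrees `N < N'` have no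
  pivot-type degree and no cross degree `pₖ + qₗ` strictly between them (a non-negative coefficient at `N` or `N'` leaves `K` negatives;
  otherwise the window lemma `Census.signVariations_window_two_ended`).
So the conjectured `2K − 2` of the block question holds OFF THE INTERLEAVING LOCUS for every `(K_u, K_v)` (e.g. `(2,3)`: `8`; `(3,3)`:
`10`); on the locus (every gap between consecutive pivot-type degrees contains a cross degree) only `(2,2)` is settled (kill-five,
`…BlockLaw/BlockLawII`).  Nothing here bears on `MatrixDescartes` in its window, on `DoorA26` / `DoorA34`, registers / credences, or
`VP ≠ VNP`.

[folklore] Descartes bookkeeping; tree lemmas named above.  No definitions, no named facts.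
-/

-- `Summit.ValiantsHypothesis.ValiantsHypothesis.…` repeats a component by the D-0017 layout
-- (single-conjunct summit), which the `dupNamespace` linter flags; the name is mandated.
set_option linter.dupNamespace false

namespace Summit.ValiantsHypothesis.ValiantsHypothesis.Theorems.LacunarySymmetroidMatrixDescartes.Pivot.TwoDirections.Ends

open Polynomial Matrix Finset
open scoped BigOperators

/-! ## 1. Coefficients of the two-direction determinant `Φ = X^{2e}·dJ + X^e f·mu + X^e g·mv + f g·D2` -/

/-- A product of polynomials with non-negative coefficients has non-negative coefficients. [folklore] -/
theorem coeff_mul_nonneg_of_nonneg (f g : ℝ[X]) (hf : ∀ i, 0 ≤ f.coeff i) (hg : ∀ j, 0 ≤ g.coeff j) (n : ℕ) :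
    0 ≤ (f * g).coeff n := by
  rw [coeff_mul]
  exact Finset.sum_nonneg fun x _ => mul_nonneg (hf _) (hg _)

/-- The coefficient of `f·g` at `n` vanishes if no splitting `n = i + j` has `f.coeff i ≠ 0` and `g.coeff j ≠ 0`. [folklore] -/
theorem coeff_mul_eq_zero_of_no_split (f g : ℝ[X]) (n : ℕ) (h : ∀ i j, i + j = n → f.coeff i = 0 ∨ g.coeff j = 0) :
    (f * g).coeff n = 0 := by
  rw [coeff_mul]
  refine Finset.sum_eq_zero fun x hx => ?_
  have hx' : x.1 + x.2 = n := by simpa using hx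
  rcases h x.1 x.2 hx' with h0 | h0 <;> simp [h0]

/-- The coefficients of `Φ`. [folklore] -/
theorem coeff_twoDirDet (e : ℕ) (f g : ℝ[X]) (dJ mu mv D2 : ℝ) (n : ℕ) :
    ((X : ℝ[X]) ^ (2 * e) * Polynomial.C dJ + (X : ℝ[X]) ^ e * f * Polynomial.C mu + (X : ℝ[X]) ^ e * g * Polynomial.C mv
        + f * g * Polynomial.C D2).coeff n
      = (if n = 2 * e then dJ else 0) + mu * (if e ≤ n then f.coeff (n - e) else 0)
        + mv * (if e ≤ n then g.coeff (n - e) else 0) + D2 * (f * g).coeff n := by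
  simp only [coeff_add, coeff_mul_C, coeff_X_pow_mul', coeff_X_pow]
  split_ifs <;> ring

/-! ## 2. Where the negative coefficients are, and the two ends -/

/-- **Sign law.**  With `f, g` of non-negative coefficients and `D2 ≥ 0`, a negative coefficient of `Φ` sits at `2e`, at `e + i` with
`f.coeff i ≠ 0`, or at `e + j` with `g.coeff j ≠ 0`. [folklore] -/
theorem negSupp_subset (e : ℕ) (f g : ℝ[X]) (dJ mu mv D2 : ℝ) (hf0 : ∀ i, 0 ≤ f.coeff i) (hg0 : ∀ j, 0 ≤ g.coeff j)
    (hD2 : 0 ≤ D2) :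
    Pivot.TwoDescartes.negSupp ((X : ℝ[X]) ^ (2 * e) * Polynomial.C dJ + (X : ℝ[X]) ^ e * f * Polynomial.C mu
        + (X : ℝ[X]) ^ e * g * Polynomial.C mv + f * g * Polynomial.C D2)
      ⊆ insert (2 * e) ((f.support.image fun i => i + e) ∪ (g.support.image fun j => j + e)) := by
  classical
  intro n hn
  simp only [Pivot.TwoDescartes.negSupp, Finset.mem_filter] at hn
  have h := hn.2
  rw [coeff_twoDirDet] at h
  rw [Finset.mem_insert, Finset.mem_union, Finset.mem_image, Finset.mem_image]
  by_contra hnot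
  push Not at hnot
  obtain ⟨h2e, hf', hg'⟩ := hnot
  have hprod := coeff_mul_nonneg_of_nonneg f g hf0 hg0 n
  have t1 : (if n = 2 * e then dJ else 0) = 0 := if_neg h2e
  have t2 : mu * (if e ≤ n then f.coeff (n - e) else 0) = 0 := by
    split_ifs with hle
    · have : f.coeff (n - e) = 0 := by
        by_contra hne
        exact hf' (n - e) (Polynomial.mem_support_iff.mpr hne) (by omega)
      rw [this, mul_zero]
    · rw [mul_zero]
  have t3 : mv * (if e ≤ n then g.coeff (n - e) else 0) = 0 := by
    split_ifs with hle
    · have : g.coeff (n - e) = 0 := by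
        by_contra hne
        exact hg' (n - e) (Polynomial.mem_support_iff.mpr hne) (by omega)
      rw [this, mul_zero]
    · rw [mul_zero]
  rw [t1, t2, t3] at h
  have : 0 ≤ D2 * (f * g).coeff n := mul_nonneg hD2 hprod
  linarith

/-- **The lowest coefficient** of `Φ` (sign-separated case: `f ≠ 0` carries only degrees `< e`, `g` only degrees `> e`) sits at
`e + natTrailingDegree f` and equals `mu · trailingCoeff f`. [folklore] -/
theorem trailingCoeff_twoDirDet (e : ℕ) (f g : ℝ[X]) (dJ mu mv D2 : ℝ) (hf : f ≠ 0) (hfe : ∀ i, f.coeff i ≠ 0 → i < e)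
    (hge : ∀ j, g.coeff j ≠ 0 → e < j) (hmu : mu ≠ 0) :
    ((X : ℝ[X]) ^ (2 * e) * Polynomial.C dJ + (X : ℝ[X]) ^ e * f * Polynomial.C mu + (X : ℝ[X]) ^ e * g * Polynomial.C mv
        + f * g * Polynomial.C D2).trailingCoeff = mu * f.trailingCoeff := by
  set Φ := (X : ℝ[X]) ^ (2 * e) * Polynomial.C dJ + (X : ℝ[X]) ^ e * f * Polynomial.C mu
    + (X : ℝ[X]) ^ e * g * Polynomial.C mv + f * g * Polynomial.C D2 with hΦ
  set t₀ := f.natTrailingDegree with ht₀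
  have hft : f.coeff t₀ ≠ 0 := mt trailingCoeff_eq_zero.mp hf
  have ht₀e : t₀ < e := hfe _ hft
  have hfg : ∀ m, m ≤ e + t₀ → (f * g).coeff m = 0 := by
    intro m hm
    refine coeff_mul_eq_zero_of_no_split f g m fun i j hij => ?_
    by_cases hi : f.coeff i = 0
    · exact Or.inl hi
    · right
      by_contra hj
      have h1 : t₀ ≤ i := natTrailingDegree_le_of_ne_zero hi
      have h2 : e < j := hge j hj
      omega
  have hcoef : Φ.coeff (e + t₀) = mu * f.coeff t₀ := by
    rw [hΦ, coeff_twoDirDet, if_neg (by omega), if_pos (by omega), if_pos (by omega), hfg _ le_rfl]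
    have hg0 : g.coeff (e + t₀ - e) = 0 := by
      by_contra hne; have := hge _ hne; omega
    rw [hg0, show e + t₀ - e = t₀ by omega]
    ring
  have hlow : ∀ m, m < e + t₀ → Φ.coeff m = 0 := by
    intro m hm
    rw [hΦ, coeff_twoDirDet, if_neg (by omega), hfg _ hm.le]
    have h1 : (if e ≤ m then f.coeff (m - e) else 0) = 0 := by
      split_ifs with h
      · exact coeff_eq_zero_of_lt_natTrailingDegree (by omega)
      · rfl
    have h2 : (if e ≤ m then g.coeff (m - e) else 0) = 0 := by
      split_ifs with h
      · by_contra hne; have := hge _ hne; omega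
      · rfl
    rw [h1, h2]; ring
  have hnz : Φ.coeff (e + t₀) ≠ 0 := by rw [hcoef]; exact mul_ne_zero hmu hft
  have hne : Φ ≠ 0 := fun h0 => hnz (by rw [h0, coeff_zero])
  have h1 : Φ.natTrailingDegree ≤ e + t₀ := natTrailingDegree_le_of_ne_zero hnz
  have h2 : e + t₀ ≤ Φ.natTrailingDegree := le_natTrailingDegree hne fun m hm => hlow m hm
  change Φ.coeff Φ.natTrailingDegree = mu * f.coeff t₀
  rw [le_antisymm h1 h2, hcoef]

/-- **The highest coefficient** of `Φ` (same setting, `g ≠ 0`) sits at `e + natDegree g` and equals `mv · leadingCoeff g`. [folklore] -/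
theorem leadingCoeff_twoDirDet (e : ℕ) (f g : ℝ[X]) (dJ mu mv D2 : ℝ) (hg : g ≠ 0) (hfe : ∀ i, f.coeff i ≠ 0 → i < e)
    (hge : ∀ j, g.coeff j ≠ 0 → e < j) (hmv : mv ≠ 0) :
    ((X : ℝ[X]) ^ (2 * e) * Polynomial.C dJ + (X : ℝ[X]) ^ e * f * Polynomial.C mu + (X : ℝ[X]) ^ e * g * Polynomial.C mv
        + f * g * Polynomial.C D2).leadingCoeff = mv * g.leadingCoeff := by
  set Φ := (X : ℝ[X]) ^ (2 * e) * Polynomial.C dJ + (X : ℝ[X]) ^ e * f * Polynomial.C mu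
    + (X : ℝ[X]) ^ e * g * Polynomial.C mv + f * g * Polynomial.C D2 with hΦ
  set D := g.natDegree with hD
  have hgD : g.coeff D ≠ 0 := mt leadingCoeff_eq_zero.mp hg
  have heD : e < D := hge _ hgD
  have hfg : ∀ m, e + D ≤ m → (f * g).coeff m = 0 := by
    intro m hm
    refine coeff_mul_eq_zero_of_no_split f g m fun i j hij => ?_
    by_cases hi : f.coeff i = 0
    · exact Or.inl hi
    · right
      have h1 : i < e := hfe i hi
      exact coeff_eq_zero_of_natDegree_lt (by omega)
  have hcoef : Φ.coeff (e + D) = mv * g.coeff D := by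
    rw [hΦ, coeff_twoDirDet, if_neg (by omega), if_pos (by omega), if_pos (by omega), hfg _ le_rfl]
    have hf0 : f.coeff (e + D - e) = 0 := by
      by_contra hne; have := hfe _ hne; omega
    rw [hf0, show e + D - e = D by omega]
    ring
  have hhigh : ∀ m, e + D < m → Φ.coeff m = 0 := by
    intro m hm
    rw [hΦ, coeff_twoDirDet, if_neg (by omega), hfg _ hm.le]
    have h1 : (if e ≤ m then f.coeff (m - e) else 0) = 0 := by
      rw [if_pos (by omega)]
      by_contra hne; have := hfe _ hne; omega
    have h2 : (if e ≤ m then g.coeff (m - e) else 0) = 0 := by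
      rw [if_pos (by omega)]
      exact coeff_eq_zero_of_natDegree_lt (by omega)
    rw [h1, h2]; ring
  have hnz : Φ.coeff (e + D) ≠ 0 := by rw [hcoef]; exact mul_ne_zero hmv hgD
  have hle : Φ.natDegree ≤ e + D := by
    refine natDegree_le_iff_coeff_eq_zero.mpr fun m hm => hhigh m ?_
    exact_mod_cast hm
  have hdeg : Φ.natDegree = e + D := natDegree_eq_of_le_of_coeff_ne_zero hle hnz
  change Φ.coeff Φ.natDegree = mv * g.coeff D
  rw [hdeg, hcoef]

/-! ## 3. The counts -/

/-- **SIGN-SEPARATED TWO-DIRECTION PENCILS: `Z₊ ≤ 2K`** (`K` = the number of monomials of `f` plus that of `g`).  `Φ` as above with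
`f ≠ 0 ≠ g` of non-negative coefficients on degrees `< e` resp. `> e`, `D2 ≥ 0`, both pairings negative (`mu, mv < 0`), `dJ`
arbitrary: both end coefficients of `Φ` are negative, so the two-ended budget gives `Var ≤ 2(K + 1) − 2`. [this file] -/
theorem twoDir_posRoots_le (e : ℕ) (f g : ℝ[X]) (dJ mu mv D2 : ℝ) (hf : f ≠ 0) (hg : g ≠ 0)
    (hf0 : ∀ i, 0 ≤ f.coeff i) (hg0 : ∀ j, 0 ≤ g.coeff j) (hfe : ∀ i, f.coeff i ≠ 0 → i < e) (hge : ∀ j, g.coeff j ≠ 0 → e < j)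
    (hD2 : 0 ≤ D2) (hmu : mu < 0) (hmv : mv < 0) :
    ((((X : ℝ[X]) ^ (2 * e) * Polynomial.C dJ + (X : ℝ[X]) ^ e * f * Polynomial.C mu + (X : ℝ[X]) ^ e * g * Polynomial.C mv
        + f * g * Polynomial.C D2).roots.toFinset.filter (fun t => 0 < t)).card) ≤ 2 * (f.support.card + g.support.card) := by
  classical
  set Φ := (X : ℝ[X]) ^ (2 * e) * Polynomial.C dJ + (X : ℝ[X]) ^ e * f * Polynomial.C mu
    + (X : ℝ[X]) ^ e * g * Polynomial.C mv + f * g * Polynomial.C D2 with hΦ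
  have htr : Φ.trailingCoeff < 0 := by
    rw [hΦ, trailingCoeff_twoDirDet e f g dJ mu mv D2 hf hfe hge hmu.ne]
    have : 0 < f.trailingCoeff := lt_of_le_of_ne (hf0 _) (Ne.symm (mt trailingCoeff_eq_zero.mp hf))
    exact mul_neg_of_neg_of_pos hmu this
  have hld : Φ.leadingCoeff < 0 := by
    rw [hΦ, leadingCoeff_twoDirDet e f g dJ mu mv D2 hg hfe hge hmv.ne]
    have : 0 < g.leadingCoeff := lt_of_le_of_ne (hg0 _) (Ne.symm (mt leadingCoeff_eq_zero.mp hg))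
    exact mul_neg_of_neg_of_pos hmv this
  have hsub : Pivot.TwoDescartes.negSupp Φ
      ⊆ insert (2 * e) ((f.support.image fun i => i + e) ∪ (g.support.image fun j => j + e)) :=
    negSupp_subset e f g dJ mu mv D2 hf0 hg0 hD2
  have hcard : (insert (2 * e) ((f.support.image fun i => i + e) ∪ (g.support.image fun j => j + e))).card
      ≤ 1 + (f.support.card + g.support.card) := by
    refine (Finset.card_insert_le _ _).trans ?_
    have := (Finset.card_union_le _ _).trans (Nat.add_le_add (Finset.card_image_le (s := f.support) (f := fun i => i + e))
      (Finset.card_image_le (s := g.support) (f := fun j => j + e)))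
    omega
  have hb := Census.signVariations_two_ended_le Φ
  rw [if_pos hld, if_pos htr] at hb
  have hc := (Finset.card_le_card hsub).trans hcard
  have hZ := Census.card_posRoots_le_signVariations Φ
  omega

/-- **… AND `Z₊ ≤ 2K − 2` OFF THE INTERLEAVING LOCUS.**  Same setting; if two of the pivot-type degrees `N < N'`
(`N, N' ∈ {2e} ∪ (e + supp f) ∪ (e + supp g)`) have no pivot-type degree and no cross degree `i + j` (`i ∈ supp f`, `j ∈ supp g`)
strictly between them, then `Z₊ ≤ 2K − 2` (a non-negative coefficient at `N` or `N'` leaves `K` negative coefficients; otherwise the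
window lemma).  For `(K_u, K_v) = (2,2)` this is the Descartes half of the BLOCK `(2,2)` LAW (`…BlockLawAll`); for `(2,3)` it gives `8`,
for `(3,3)` `10` off the locus — the conjectured `2K − 2` of the BLOCK QUESTION of `…PivotTwoDirections`. [this file] -/
theorem twoDir_posRoots_le_of_gap (e : ℕ) (f g : ℝ[X]) (dJ mu mv D2 : ℝ) (hf : f ≠ 0) (hg : g ≠ 0)
    (hf0 : ∀ i, 0 ≤ f.coeff i) (hg0 : ∀ j, 0 ≤ g.coeff j) (hfe : ∀ i, f.coeff i ≠ 0 → i < e) (hge : ∀ j, g.coeff j ≠ 0 → e < j)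
    (hD2 : 0 ≤ D2) (hmu : mu < 0) (hmv : mv < 0) (N N' : ℕ) (hNN' : N < N')
    (hN : N = 2 * e ∨ (∃ i, f.coeff i ≠ 0 ∧ N = i + e) ∨ (∃ j, g.coeff j ≠ 0 ∧ N = j + e))
    (hN' : N' = 2 * e ∨ (∃ i, f.coeff i ≠ 0 ∧ N' = i + e) ∨ (∃ j, g.coeff j ≠ 0 ∧ N' = j + e))
    (hgap_e : ¬ (N < 2 * e ∧ 2 * e < N')) (hgap_f : ∀ i, f.coeff i ≠ 0 → ¬ (N < i + e ∧ i + e < N'))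
    (hgap_g : ∀ j, g.coeff j ≠ 0 → ¬ (N < j + e ∧ j + e < N'))
    (hgap_x : ∀ i j, f.coeff i ≠ 0 → g.coeff j ≠ 0 → ¬ (N < i + j ∧ i + j < N')) :
    ((((X : ℝ[X]) ^ (2 * e) * Polynomial.C dJ + (X : ℝ[X]) ^ e * f * Polynomial.C mu + (X : ℝ[X]) ^ e * g * Polynomial.C mv
        + f * g * Polynomial.C D2).roots.toFinset.filter (fun t => 0 < t)).card) + 2 ≤ 2 * (f.support.card + g.support.card) := by
  classical
  set Φ := (X : ℝ[X]) ^ (2 * e) * Polynomial.C dJ + (X : ℝ[X]) ^ e * f * Polynomial.C mu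
    + (X : ℝ[X]) ^ e * g * Polynomial.C mv + f * g * Polynomial.C D2 with hΦ
  have htr : Φ.trailingCoeff < 0 := by
    rw [hΦ, trailingCoeff_twoDirDet e f g dJ mu mv D2 hf hfe hge hmu.ne]
    have : 0 < f.trailingCoeff := lt_of_le_of_ne (hf0 _) (Ne.symm (mt trailingCoeff_eq_zero.mp hf))
    exact mul_neg_of_neg_of_pos hmu this
  have hld : Φ.leadingCoeff < 0 := by
    rw [hΦ, leadingCoeff_twoDirDet e f g dJ mu mv D2 hg hfe hge hmv.ne]
    have : 0 < g.leadingCoeff := lt_of_le_of_ne (hg0 _) (Ne.symm (mt leadingCoeff_eq_zero.mp hg))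
    exact mul_neg_of_neg_of_pos hmv this
  set S : Finset ℕ := insert (2 * e) ((f.support.image fun i => i + e) ∪ (g.support.image fun j => j + e)) with hS
  have hsub : Pivot.TwoDescartes.negSupp Φ ⊆ S := negSupp_subset e f g dJ mu mv D2 hf0 hg0 hD2
  have hcard : S.card ≤ 1 + (f.support.card + g.support.card) := by
    refine (Finset.card_insert_le _ _).trans ?_
    have := (Finset.card_union_le _ _).trans (Nat.add_le_add (Finset.card_image_le (s := f.support) (f := fun i => i + e))
      (Finset.card_image_le (s := g.support) (f := fun j => j + e)))
    omega
  have hmemS : ∀ M, (M = 2 * e ∨ (∃ i, f.coeff i ≠ 0 ∧ M = i + e) ∨ (∃ j, g.coeff j ≠ 0 ∧ M = j + e)) → M ∈ S := by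
    intro M hM
    rw [hS, Finset.mem_insert, Finset.mem_union, Finset.mem_image, Finset.mem_image]
    rcases hM with h | ⟨i, hi, h⟩ | ⟨j, hj, h⟩
    · exact Or.inl h
    · exact Or.inr (Or.inl ⟨i, Polynomial.mem_support_iff.mpr hi, h.symm⟩)
    · exact Or.inr (Or.inr ⟨j, Polynomial.mem_support_iff.mpr hj, h.symm⟩)
  have hNS := hmemS N hN
  have hN'S := hmemS N' hN'
  have hZ := Census.card_posRoots_le_signVariations Φ
  -- Step 1: a non-negative coefficient at `N` or `N'`
  have step1 : ∀ s, s ∈ S → 0 ≤ Φ.coeff s →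
      (Φ.roots.toFinset.filter (fun t => 0 < t)).card + 2 ≤ 2 * (f.support.card + g.support.card) := by
    intro s hs h0
    have hsub' : Pivot.TwoDescartes.negSupp Φ ⊆ S.erase s := by
      intro n hn
      refine Finset.mem_erase.mpr ⟨fun h => ?_, hsub hn⟩
      simp only [Pivot.TwoDescartes.negSupp, Finset.mem_filter] at hn
      rw [h] at hn; exact absurd hn.2 (not_lt.mpr h0)
    have hb := Census.signVariations_two_ended_le Φ
    rw [if_pos hld, if_pos htr] at hb
    have hc := Finset.card_le_card hsub'
    rw [Finset.card_erase_of_mem hs] at hc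
    have : 1 ≤ S.card := Finset.card_pos.mpr ⟨s, hs⟩
    omega
  by_cases h1 : 0 ≤ Φ.coeff N
  · exact step1 N hNS h1
  by_cases h2 : 0 ≤ Φ.coeff N'
  · exact step1 N' hN'S h2
  push Not at h1 h2
  -- Step 2: the window `[N, N']`
  have hwin : ∀ m, N ≤ m → m ≤ N' → Φ.coeff m ≤ 0 := by
    intro m ha hb
    rcases Nat.eq_or_lt_of_le ha with h | h
    · rw [← h]; exact h1.le
    rcases Nat.eq_or_lt_of_le hb with h' | h'
    · rw [h']; exact h2.le
    rw [hΦ, coeff_twoDirDet, if_neg (fun h2e => hgap_e ⟨by omega, by omega⟩)]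
    have t2 : (if e ≤ m then f.coeff (m - e) else 0) = 0 := by
      split_ifs with hle
      · by_contra hne; exact hgap_f _ hne ⟨by omega, by omega⟩
      · rfl
    have t3 : (if e ≤ m then g.coeff (m - e) else 0) = 0 := by
      split_ifs with hle
      · by_contra hne; exact hgap_g _ hne ⟨by omega, by omega⟩
      · rfl
    have t4 : (f * g).coeff m = 0 := by
      refine coeff_mul_eq_zero_of_no_split f g m fun i j hij => ?_
      by_cases hi : f.coeff i = 0
      · exact Or.inl hi
      by_cases hj : g.coeff j = 0
      · exact Or.inr hj
      exact absurd ⟨by omega, by omega⟩ (hgap_x i j hi hj)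
    rw [t2, t3, t4]; simp
  have hw := Census.signVariations_window_two_ended Φ N N' hNN'.le hwin ((S.erase N).erase N')
    (fun m hm hout => by
      have hmS : m ∈ S := hsub (by
        simp only [Pivot.TwoDescartes.negSupp, Finset.mem_filter, Polynomial.mem_support_iff]
        exact ⟨hm.ne, hm⟩)
      exact Finset.mem_erase.mpr ⟨by omega, Finset.mem_erase.mpr ⟨by omega, hmS⟩⟩)
  rw [if_pos hld, if_pos htr] at hw
  have hc1 : ((S.erase N).erase N').card + 2 = S.card := by
    have hN'm : N' ∈ S.erase N := Finset.mem_erase.mpr ⟨by omega, hN'S⟩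
    rw [Finset.card_erase_of_mem hN'm, Finset.card_erase_of_mem hNS]
    have : 2 ≤ S.card := by
      have hsub2 : ({N, N'} : Finset ℕ) ⊆ S := by
        intro x hx
        simp only [Finset.mem_insert, Finset.mem_singleton] at hx
        rcases hx with rfl | rfl
        · exact hNS
        · exact hN'S
      have := Finset.card_le_card hsub2
      rw [Finset.card_pair (by omega)] at this
      exact this
    omega
  omega

/-! ## 4. Matrix forms -/

/-- **Matrix form of `twoDir_posRoots_le`**: `F = X^e J + f·u uᵀ + g·v vᵀ` with direction posynomials `f` (degrees `< e`) and `g`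
(degrees `> e`), both non-zero with non-negative coefficients, both directions core (`m(J,u) < 0`, `m(J,v) < 0`), `J` otherwise
arbitrary: `Z₊ ≤ 2K`, `K = #supp f + #supp g`. [this file] -/
theorem twoDir_det_posRoots_le (e : ℕ) (J : Matrix (Fin 2) (Fin 2) ℝ) (u v : Fin 2 → ℝ) (f g : ℝ[X]) (hf : f ≠ 0) (hg : g ≠ 0)
    (hf0 : ∀ i, 0 ≤ f.coeff i) (hg0 : ∀ j, 0 ≤ g.coeff j) (hfe : ∀ i, f.coeff i ≠ 0 → i < e) (hge : ∀ j, g.coeff j ≠ 0 → e < j)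
    (hmu : J 0 0 * u 1 ^ 2 + J 1 1 * u 0 ^ 2 - (J 0 1 + J 1 0) * (u 0 * u 1) < 0)
    (hmv : J 0 0 * v 1 ^ 2 + J 1 1 * v 0 ^ 2 - (J 0 1 + J 1 0) * (v 0 * v 1) < 0) :
    ((Matrix.det (((X : ℝ[X]) ^ e) • J.map Polynomial.C + f • (vecMulVec u u).map Polynomial.C
        + g • (vecMulVec v v).map Polynomial.C)).roots.toFinset.filter (fun t => 0 < t)).card
      ≤ 2 * (f.support.card + g.support.card) := by
  rw [det_twoDir]
  exact twoDir_posRoots_le e f g J.det _ _ _ hf hg hf0 hg0 hfe hge (sq_nonneg _) hmu hmv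

/-- **Matrix form of `twoDir_posRoots_le_of_gap`**: same pencil, off the interleaving locus: `Z₊ + 2 ≤ 2K`. [this file] -/
theorem twoDir_det_posRoots_le_of_gap (e : ℕ) (J : Matrix (Fin 2) (Fin 2) ℝ) (u v : Fin 2 → ℝ) (f g : ℝ[X]) (hf : f ≠ 0)
    (hg : g ≠ 0) (hf0 : ∀ i, 0 ≤ f.coeff i) (hg0 : ∀ j, 0 ≤ g.coeff j) (hfe : ∀ i, f.coeff i ≠ 0 → i < e)
    (hge : ∀ j, g.coeff j ≠ 0 → e < j)
    (hmu : J 0 0 * u 1 ^ 2 + J 1 1 * u 0 ^ 2 - (J 0 1 + J 1 0) * (u 0 * u 1) < 0)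
    (hmv : J 0 0 * v 1 ^ 2 + J 1 1 * v 0 ^ 2 - (J 0 1 + J 1 0) * (v 0 * v 1) < 0) (N N' : ℕ) (hNN' : N < N')
    (hN : N = 2 * e ∨ (∃ i, f.coeff i ≠ 0 ∧ N = i + e) ∨ (∃ j, g.coeff j ≠ 0 ∧ N = j + e))
    (hN' : N' = 2 * e ∨ (∃ i, f.coeff i ≠ 0 ∧ N' = i + e) ∨ (∃ j, g.coeff j ≠ 0 ∧ N' = j + e))
    (hgap_e : ¬ (N < 2 * e ∧ 2 * e < N')) (hgap_f : ∀ i, f.coeff i ≠ 0 → ¬ (N < i + e ∧ i + e < N'))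
    (hgap_g : ∀ j, g.coeff j ≠ 0 → ¬ (N < j + e ∧ j + e < N'))
    (hgap_x : ∀ i j, f.coeff i ≠ 0 → g.coeff j ≠ 0 → ¬ (N < i + j ∧ i + j < N')) :
    ((Matrix.det (((X : ℝ[X]) ^ e) • J.map Polynomial.C + f • (vecMulVec u u).map Polynomial.C
        + g • (vecMulVec v v).map Polynomial.C)).roots.toFinset.filter (fun t => 0 < t)).card + 2
      ≤ 2 * (f.support.card + g.support.card) := by
  rw [det_twoDir]
  exact twoDir_posRoots_le_of_gap e f g J.det _ _ _ hf hg hf0 hg0 hfe hge (sq_nonneg _) hmu hmv N N' hNN' hN hN' hgap_e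
    hgap_f hgap_g hgap_x

end Summit.ValiantsHypothesis.ValiantsHypothesis.Theorems.LacunarySymmetroidMatrixDescartes.Pivot.TwoDirections.Ends
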